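import Literature.NumberTheory.QuadraticForms.HilbertSymbolPlaces
import Literature.NumberTheory.QuadraticForms.HilbertSymbolPrescribedProofs
import Literature.NumberTheory.QuadraticForms.LocalNormIndex
import HarnessLib

/-!
# Hilbert reciprocity reduced to a single exceptional place (O'Meara §71D, step 1)

Topic `NumberTheory/QuadraticForms`; namespace `Literature.NumberTheory.QuadraticForms`; all
declarations fully proved. The first step of O'Meara's proof of Hilbert's reciprocity law
(*Introduction to quadratic forms*, Thm. 71:18, proof, step 1 and the first lines of step 2):
**if, for some `a b ∈ Kˣ`, the number of places `𝔭` of the number field `K` with `(a, b)_𝔭 = -1`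
were odd, then there would be `a' ∈ Kˣ` with `(a', b)_𝔭 = -1` at exactly one place `𝔮`**
(finite or — necessarily real — infinite): `exists_hilbertSymbol_eq_neg_one_unique`. The only
class-field-theoretic input is the *second inequality* `(J_K : P_K N_{E/K} J_E) ∣ 2` for
`E = K(√b)` (the named fact `normIdeles_index_dvd_two K` of `QuadraticNormIndex.lean`, what
O'Meara's proof of Prop. 65:21 establishes); O'Meara quotes 65:21 itself (index `= 2`), but only
`≤ 2` is used.

## The argument

Write `Bad(a)` for the set of places (finite and infinite together: the type
`HeightOneSpectrum (𝓞 K) ⊕ InfinitePlace K`) where `(a, b)_𝔭 = -1`, a finite set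
(`finite_setOf_hilbertSymbol_eq_neg_one`, `HilbertReciprocityFiniteness.lean`). At a place of
`Bad(a)` the element `b` is a local non-square, so there is an idèle `i_𝔭 ∈ I_K^𝔭` which is a local
non-norm from `K_𝔭(√b)` exactly at `𝔭` (O'Meara 63:13 at a finite place —
`adicCompletion_exists_hilbertSymbol_eq_neg_one_holds`, `LocalNormIndex.lean`; `-1` at a real
place). Let `G = P_K · N_{E/K} J_E = principalIdeles K ⊔ normIdeles K b`, of index `1` or `2`.
For two distinct places `𝔭 ≠ 𝔮` of `Bad(a)`: if `i_𝔭 ∈ G`, reading `i_𝔭 = (γ) n` off gives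
`γ ∈ Kˣ` with `Bad(γ) = {𝔭}` (the places where `i_𝔭` is a local non-norm are those where
`(γ, b) = -1`, O'Meara §65A); likewise if `i_𝔮 ∈ G`; otherwise `i_𝔭 i_𝔮 ∈ G` (index `2`) and
`Bad(γ) = {𝔭, 𝔮}` for the corresponding `γ` (`exists_badPlaces_eq_singleton_or_pair`). In the last
case `Bad(a γ) = Bad(a) ∆ Bad(γ) = Bad(a) ∖ {𝔭, 𝔮}` by the multiplicativity of the local symbols in
the first variable (`hilbertSymbol_adicCompletion_mul_left`, local norm index `2` at every finite
place, `HilbertSymbolBilinear.lean`; `hilbertSymbol_completion_mul_left` at the infinite places,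
proved here), which has odd cardinality `|Bad(a)| - 2`: induction.

O'Meara phrases step 1 with three spots `𝔭₁, 𝔭₂, 𝔭₃` and index exactly `2`; the version above
needs two spots and index `≤ 2`.

## References

* O. T. O'Meara, *Introduction to quadratic forms*, Grundlehren 117, Springer (1963), §63B
  (63:13), §65A (local norms, Example 65:2), §65D (65:21), §71D (proof of Thm. 71:18, step 1;
  PDF p. 207).
-/


noncomputable section

open NumberField IsDedekindDomain

namespace Literature.NumberTheory.QuadraticForms

section Places

variable {K : Type} [Field K] [NumberField K]

/-! ### Idèles that are local non-norms at exactly one place -/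

/-- **A local non-norm idèle at a place where `(a, b) = -1`.** If `(a, b)_𝔭 = -1` then `b` is a
non-square at `𝔭`, and there is an idèle `i ∈ I_K^𝔭` (all components `1` but the `𝔭`-th) which is
a local non-norm from `K_𝔭(√b)` at `𝔭` and a local norm everywhere else: at a finite place by
O'Meara 63:13 (`adicCompletion_exists_hilbertSymbol_eq_neg_one_holds`), at a real place the idèle
with component `-1` (`x² - b y² > 0` there). [cite: Omeara1963, §71D proof of Thm. 71:18 (step 1)] -/
theorem exists_idele_not_isLocalNormAt_iff {a b : K} (ha : a ≠ 0) (hb : b ≠ 0)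
    {p : HeightOneSpectrum (𝓞 K) ⊕ InfinitePlace K} (hp : placeSymbol a b p = -1) :
    ∃ i : GaloisRepresentations.ideleGroup K, ∀ q, ¬ IsLocalNormAt b i q ↔ q = p := by
  classical
  cases p with
  | inl v =>
    haveI : CharZero (v.adicCompletion K) :=
      charZero_of_injective_algebraMap (algebraMap K _).injective
    have hbv : algebraMap K (v.adicCompletion K) b ≠ 0 := (map_ne_zero _).2 hb
    have hnsq : ¬ IsSquare (algebraMap K (v.adicCompletion K) b) := fun hsq ↦ by
      rw [placeSymbol_inl, hilbertSymbol_comm, hilbertSymbol_eq_one_of_isSquare hsq hbv] at hp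
      norm_num at hp
    obtain ⟨t, ht0, ht⟩ := adicCompletion_exists_hilbertSymbol_eq_neg_one_holds K v _ hbv hnsq
    have htN : Units.mk0 t ht0 ∉ quadraticNormSubgroup (v.adicCompletion K) (algebraMap K _ b) :=
      (hilbertSymbol_eq_neg_one_iff_not_mem_quadraticNormSubgroup hbv (Units.mk0 t ht0)).1 ht
    refine ⟨GaloisRepresentations.localUnits v (Units.mk0 t ht0), fun q ↦ ?_⟩
    cases q with
    | inl v' =>
      by_cases hv : v' = v
      · subst hv
        rw [isLocalNormAt_inl, ideleFiniteComponent_localUnits_self]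
        exact ⟨fun _ ↦ rfl, fun _ ↦ htN⟩
      · rw [isLocalNormAt_inl, ideleFiniteComponent_localUnits_of_ne K _ hv]
        simp only [one_mem, not_true_eq_false, Sum.inl.injEq, hv]
    | inr w =>
      rw [isLocalNormAt_inr, ideleInfiniteComponent_localUnits]
      simp only [one_mem, not_true_eq_false, reduceCtorEq]
  | inr w =>
    have hw : w.IsReal := isReal_of_hilbertSymbol_completion_eq_neg_one (Or.inl ha) hp
    have hbw : InfinitePlace.embedding_of_isReal hw b < 0 := by
      rw [placeSymbol_inr, hilbertSymbol_completion_eq_neg_one_iff_of_isReal hw] at hp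
      exact lt_of_le_of_ne hp.2 ((_root_.map_ne_zero _).2 hb)
    have hN : (-1 : (w.Completion)ˣ) ∉ quadraticNormSubgroup w.Completion (algebraMap K _ b) :=
      neg_one_not_mem_quadraticNormSubgroup_of_isReal hw
        (Literature.NumberTheory.Automorphic.not_isSquare_completion_of_embedding_neg K hw hbw)
    let s : ∀ w' : InfinitePlace K, (w'.Completion)ˣ := fun w' ↦ if w' = w then -1 else 1
    refine ⟨infiniteIdeleOf K s, fun q ↦ ?_⟩
    cases q with
    | inl v =>
      rw [isLocalNormAt_inl, ideleFiniteComponent_infiniteIdeleOf]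
      simp only [one_mem, not_true_eq_false, reduceCtorEq]
    | inr w' =>
      rw [isLocalNormAt_inr, ideleInfiniteComponent_infiniteIdeleOf]
      by_cases hw' : w' = w
      · subst hw'
        simp only [s, if_true]
        exact ⟨fun _ ↦ trivial, fun _ ↦ hN⟩
      · simp only [s, hw', if_false, one_mem, not_true_eq_false, Sum.inr.injEq]

/-! ### Two exceptional places: the pairing lemma -/

/-- `(a, b)_𝔭 = -1` somewhere forces `b ∉ K²`. [folklore] -/
theorem not_isSquare_of_placeSymbol_eq_neg_one {a b : K} (hb : b ≠ 0)
    {p : HeightOneSpectrum (𝓞 K) ⊕ InfinitePlace K} (hp : placeSymbol a b p = -1) :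
    ¬ IsSquare b := fun hsq ↦ by
  cases p with
  | inl v =>
    rw [placeSymbol_inl, hilbertSymbol_comm,
      hilbertSymbol_eq_one_of_isSquare (hsq.map _) ((map_ne_zero _).2 hb)] at hp
    norm_num at hp
  | inr w =>
    rw [placeSymbol_inr, hilbertSymbol_comm,
      hilbertSymbol_eq_one_of_isSquare (hsq.map _) ((map_ne_zero _).2 hb)] at hp
    norm_num at hp

/-- **The pairing lemma** (O'Meara §71D, proof of 71:18, step 1, with the second inequality in
place of 65:21): let `𝔭 ≠ 𝔮` be places with `(a, b)_𝔭 = (a, b)_𝔮 = -1`, and assume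
`(J_K : P_K N_{E/K} J_E) ∣ 2` for `E = K(√b)` (`normIdeles_index_dvd_two K`). Then there is
`γ ∈ Kˣ` whose exceptional set `Bad(γ) = {𝔯 : (γ, b)_𝔯 = -1}` is `{𝔭}`, or `{𝔮}`, or `{𝔭, 𝔮}`:
with `i_𝔭, i_𝔮` local non-norm idèles exactly at `𝔭`, `𝔮` and `G = P_K · N_{E/K} J_E` — if
`i_𝔭 ∈ G` (resp. `i_𝔮 ∈ G`) read `γ` off `i_𝔭 = (γ) n`; otherwise `G` has index `2` and
`i_𝔭 i_𝔮 ∈ G`. [cite: Omeara1963, §71D proof of Thm. 71:18 (step 1)] -/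
theorem exists_badPlaces_eq_singleton_or_pair (h65 : normIdeles_index_dvd_two K) {a b : K}
    (ha : a ≠ 0) (hb : b ≠ 0) {p q : HeightOneSpectrum (𝓞 K) ⊕ InfinitePlace K} (hpq : p ≠ q)
    (hp : placeSymbol a b p = -1) (hq : placeSymbol a b q = -1) :
    ∃ γ : K, γ ≠ 0 ∧
      (badPlaces γ b = {p} ∨ badPlaces γ b = {q} ∨ badPlaces γ b = {p, q}) := by
  have hbsq : ¬ IsSquare b := not_isSquare_of_placeSymbol_eq_neg_one hb hp
  obtain ⟨i, hi⟩ := exists_idele_not_isLocalNormAt_iff ha hb hp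
  obtain ⟨j, hj⟩ := exists_idele_not_isLocalNormAt_iff ha hb hq
  by_cases hiG : i ∈ GaloisRepresentations.principalIdeles K ⊔ normIdeles K b
  · obtain ⟨γ, hγ⟩ := exists_placeSymbol_eq_neg_one_iff_of_mem_sup hb hiG
    refine ⟨γ, γ.ne_zero, Or.inl ?_⟩
    ext r
    rw [mem_badPlaces_iff, hγ, hi, Set.mem_singleton_iff]
  by_cases hjG : j ∈ GaloisRepresentations.principalIdeles K ⊔ normIdeles K b
  · obtain ⟨γ, hγ⟩ := exists_placeSymbol_eq_neg_one_iff_of_mem_sup hb hjG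
    refine ⟨γ, γ.ne_zero, Or.inr (Or.inl ?_)⟩
    ext r
    rw [mem_badPlaces_iff, hγ, hj, Set.mem_singleton_iff]
  -- both outside `G`: the index is `2` and `i j ∈ G`
  have h2 : (GaloisRepresentations.principalIdeles K ⊔ normIdeles K b).index = 2 := by
    rcases index_eq_one_or_eq_two_of_normIdeles_index_dvd_two h65 hbsq with h1 | h2
    · rw [Subgroup.index_eq_one] at h1
      exact absurd (h1 ▸ Subgroup.mem_top i) hiG
    · exact h2
  have hij : i * j ∈ GaloisRepresentations.principalIdeles K ⊔ normIdeles K b :=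
    (Subgroup.mul_mem_iff_of_index_two h2).2 (iff_of_false hiG hjG)
  obtain ⟨γ, hγ⟩ := exists_placeSymbol_eq_neg_one_iff_of_mem_sup hb hij
  refine ⟨γ, γ.ne_zero, Or.inr (Or.inr ?_)⟩
  ext r
  rw [mem_badPlaces_iff, hγ, Set.mem_insert_iff, Set.mem_singleton_iff]
  by_cases hrp : r = p
  · subst hrp
    have hjr : IsLocalNormAt b j r := by
      by_contra h
      exact hpq ((hj r).1 h)
    rw [isLocalNormAt_mul_iff_of_isLocalNormAt hjr, hi]
    simp
  · have hir : IsLocalNormAt b i r := by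
      by_contra h
      exact hrp ((hi r).1 h)
    rw [isLocalNormAt_mul_iff_of_isLocalNormAt_left hir, hj]
    simp [hrp]

/-! ### Induction on the number of exceptional places -/

/-- **Odd ⇒ one**: under the second inequality, if `Bad(a)` has odd cardinality for some `a ∈ Kˣ`
then some `a' ∈ Kˣ` has exactly one exceptional place (strong induction: two exceptional places of
`a` are removed at a time by the pairing lemma, `Bad(a γ) = Bad(a) ∖ {𝔭, 𝔮}`, unless a `γ` with a
single exceptional place shows up directly). [cite: Omeara1963, §71D proof of Thm. 71:18 (steps 1–2)] -/
theorem exists_badPlaces_eq_singleton (h65 : normIdeles_index_dvd_two K) {b : K} (hb : b ≠ 0)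
    (n : ℕ) : ∀ {a : K}, a ≠ 0 → (badPlaces a b).ncard = n → Odd n →
      ∃ a' : K, a' ≠ 0 ∧ ∃ p, badPlaces a' b = {p} := by
  induction n using Nat.strong_induction_on with
  | _ n ih =>
  intro a ha hn hodd
  have hfin := badPlaces_finite (K := K) ha hb
  by_cases h1 : n = 1
  · subst h1
    obtain ⟨p, hp⟩ := Set.ncard_eq_one.1 hn
    exact ⟨a, ha, p, hp⟩
  have hlt : 1 < (badPlaces a b).ncard := by
    rw [hn]
    obtain ⟨m, rfl⟩ := hodd
    omega
  obtain ⟨p, q, hp, hq, hpq⟩ := (Set.one_lt_ncard_iff hfin).1 hlt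
  rw [mem_badPlaces_iff] at hp hq
  obtain ⟨γ, hγ0, hγ⟩ := exists_badPlaces_eq_singleton_or_pair h65 ha hb hpq hp hq
  rcases hγ with h | h | h
  · exact ⟨γ, hγ0, p, h⟩
  · exact ⟨γ, hγ0, q, h⟩
  · have hsub : ({p, q} : Set (HeightOneSpectrum (𝓞 K) ⊕ InfinitePlace K)) ⊆ badPlaces a b := by
      intro r hr
      rcases hr with rfl | rfl
      · exact hp
      · exact hq
    have hcard : (badPlaces (a * γ) b).ncard = n - 2 := by
      rw [badPlaces_mul ha hγ0 hb, h, symmDiff_of_ge hsub, Set.ncard_sdiff hsub (Set.toFinite _), hn,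
        Set.ncard_pair hpq]
    have hodd' : Odd (n - 2) := by
      obtain ⟨m, rfl⟩ := hodd
      exact ⟨m - 1, by omega⟩
    exact ih (n - 2) (by omega) (mul_ne_zero ha hγ0) hcard hodd'

/-! ### Conclusion: a single exceptional place -/

/-- **O'Meara 71:18, proof, step 1 (and the opening of step 2).** Assume the second inequality
`(J_K : P_K N_{E/K} J_E) ∣ 2` for the quadratic extensions `E = K(√b)` of `K`
(`normIdeles_index_dvd_two K`). If for some `a b ∈ Kˣ` the number of places `𝔭` (finite and
infinite) with `(a, b)_𝔭 = -1` is odd — i.e. if Hilbert reciprocity failed for `a, b` — then there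
is `a' ∈ Kˣ` whose symbols `(a', b)_𝔭` are `-1` at exactly one place `𝔮`: either a single finite
place `v₀` (and `+1` at all infinite places), or a single infinite place `w₀` (and `+1` at all finite
places). [cite: Omeara1963, §71D proof of Thm. 71:18 (steps 1–2)] -/
theorem exists_hilbertSymbol_eq_neg_one_unique (h65 : normIdeles_index_dvd_two K) {a b : K}
    (ha : a ≠ 0) (hb : b ≠ 0)
    (hodd : Odd ({v : HeightOneSpectrum (𝓞 K) |
        hilbertSymbol (v.adicCompletion K) (algebraMap K _ a) (algebraMap K _ b) = -1}.ncard +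
      {w : InfinitePlace K |
        hilbertSymbol w.Completion (algebraMap K _ a) (algebraMap K _ b) = -1}.ncard)) :
    ∃ a' : K, a' ≠ 0 ∧
      ((∃ v₀ : HeightOneSpectrum (𝓞 K),
          (∀ v : HeightOneSpectrum (𝓞 K),
              hilbertSymbol (v.adicCompletion K) (algebraMap K _ a') (algebraMap K _ b) = -1 ↔
                v = v₀) ∧
            ∀ w : InfinitePlace K,
              hilbertSymbol w.Completion (algebraMap K _ a') (algebraMap K _ b) = 1) ∨
        ∃ w₀ : InfinitePlace K,
          (∀ w : InfinitePlace K,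
              hilbertSymbol w.Completion (algebraMap K _ a') (algebraMap K _ b) = -1 ↔ w = w₀) ∧
            ∀ v : HeightOneSpectrum (𝓞 K),
              hilbertSymbol (v.adicCompletion K) (algebraMap K _ a') (algebraMap K _ b) = 1) := by
  rw [← ncard_badPlaces ha hb] at hodd
  obtain ⟨a', ha', p, hp⟩ := exists_badPlaces_eq_singleton h65 hb _ ha rfl hodd
  have key : ∀ r, placeSymbol a' b r = -1 ↔ r = p := fun r ↦ by
    rw [← mem_badPlaces_iff, hp, Set.mem_singleton_iff]
  refine ⟨a', ha', ?_⟩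
  cases p with
  | inl v₀ =>
    refine Or.inl ⟨v₀, fun v ↦ ?_, fun w ↦ ?_⟩
    · rw [← placeSymbol_inl, key, Sum.inl.injEq]
    · exact (hilbertSymbol_ne_neg_one_iff _ _).1 fun h ↦ Sum.inr_ne_inl ((key (Sum.inr w)).1 h)
  | inr w₀ =>
    refine Or.inr ⟨w₀, fun w ↦ ?_, fun v ↦ ?_⟩
    · rw [← placeSymbol_inr, key, Sum.inr.injEq]
    · exact (hilbertSymbol_ne_neg_one_iff _ _).1 fun h ↦ Sum.inl_ne_inr ((key (Sum.inl v)).1 h)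

end Places

end Literature.NumberTheory.QuadraticForms
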